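import Summits.BirchSwinnertonDyer.BirchSwinnertonDyer.Theorems.ResidualThetaTransportAtTwoThetaLayerLambdaCongruenceAtTwoCuspSpanPrimeLevel
import HarnessLib

/-!
# Route `ResidualThetaTransportAtTwo`, cruxes Kμ⁺ `SignedMuVanishingAtTwoPlus` (stmt-BirchSwinnertonDyer-20689) / 21437 / Kan⁺ 20688:
# FLAT at every habitat curve of PRIME conductor (corollary of the node at every prime level, `…CuspSpanPrimeLevel`)

Cell `bsd-wall`, width seat `bsd-wall-rtt-p3-w2` g4 (2026-08-28). THEOREMS ONLY; `--supports stmt-BirchSwinnertonDyer-20688`; BSD is not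
proved by this. For `W/ℚ` good supersingular at `2` with `a₂(W) = 0`, newform `f`, and PRIME conductor `N_W`: `2 ∤ L⁻` for every Pollack pair
`(L⁺, L⁻)` of `f` at `2` — crux Kμ⁺'s registered research stub FLAT restricted to prime conductor, now a THEOREM (no certificate, no
conjecture-grade input): `flatAtTwo_of_cuspSpanEvenAtTwo` (rtt-p4) fed with `cuspSpanEvenAtTwo_prime` (this seat, p637004).

References: R. Pollack, Duke Math. J. 118 (2003) Conj. 6.3, Prop. 6.18 [Pollack2003]; [Rademacher1929] §1.
-/

set_option autoImplicit false
set_option linter.dupNamespace false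

noncomputable section

open scoped MatrixGroups

open CongruenceSubgroup WeierstrassCurve Literature.NumberTheory.EllipticCurves
  Literature.NumberTheory.EllipticCurves.ModularForms Literature.NumberTheory.EllipticCurves.Rank1Residual
  Literature.NumberTheory.IwasawaTheory Summit.BirchSwinnertonDyer.Rank1Residual.Supersingular

namespace Summit.BirchSwinnertonDyer.BirchSwinnertonDyer.Theorems.SignedMuAtTwo

variable {W : WeierstrassCurve ℚ} [W.IsElliptic] [W.IsGloballyMinimal]

/-- **FLAT at every PRIME conductor.** For `W/ℚ` good supersingular at `2` with `a₂(W) = 0` and prime conductor, and its newform `f`: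
`2 ∤ L⁻` for every Pollack pair of `f` at `2`. Unconditional (node at every prime level, `cuspSpanEvenAtTwo_prime`). BSD is not proved
by this. [cite: Pollack2003, Conj. 6.3 and Prop. 6.18] -/
theorem flatAtTwo_of_prime_conductor [NeZero (W.conductorNorm ℤ)] {f : CuspForm (Gamma0 (W.conductorNorm ℤ)) 2}
    (hf : IsNewformOf W f) (hss : GoodSS W 2) (ha : W.frobeniusTrace 2 = 0) (hN : (W.conductorNorm ℤ).Prime) :
    ∀ Lplus Lminus : IwasawaAlgebra 2, IsPollackPair f 2 Lplus Lminus → ¬ PowerSeries.C (2 : ℤ_[2]) ∣ Lminus := by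
  haveI : Fact (W.conductorNorm ℤ).Prime := ⟨hN⟩
  refine flatAtTwo_of_cuspSpanEvenAtTwo hf hss ha (cuspSpanEvenAtTwo_prime ?_)
  intro h2
  exact not_two_dvd_conductorNorm_of_goodSS hss (h2 ▸ dvd_refl _)

end Summit.BirchSwinnertonDyer.BirchSwinnertonDyer.Theorems.SignedMuAtTwo

end
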